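import Summits.BirchSwinnertonDyer.BirchSwinnertonDyer.Theorems.ClassRecordThreeCornerAtThreeShimuraWalkOrderOfClass
import Summits.BirchSwinnertonDyer.BirchSwinnertonDyer.Theorems.ClassRecordThreeCornerAtThreeShimuraWalkDescent
import HarnessLib

/-!
# The EXACT ORDER of a carrier-style Kolyvagin class and the ROOT CLASS `c_{p^k}(P∕p^μ)` — dictionary entries hκt (order clause) of the
# per-level engine and hκ0 of the swap engine for the labelled CM family, generic in the carrier (cell `bsd-stepL`, seat
# `bsd-stepL-corner3-p2` g8 = WIDTH-LEVER lane B; `--supports stmt-BirchSwinnertonDyer-21420 --as helper`)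

WHY (PORT-SPEC §3c (a), HOME/corner3/g7/CORNER3-G7.md). The family-agnostic engines of the Jetchev walk (p593074 per-level, p593233 swap)
consume, for the classes `κ s ∈ H¹(K, E[p^k])` of the labelled family, (hκt) a ROOT CLASS `x` of exact order `p^k` with `κ s = p^{m(s)} • x`,
and (hκ0) `κ̄ s ≠ 0 ↔ ¬ p^{μ+1} ∣ P_s`. For carrier-style classes — `c_n(P)` of a point `P` of a `Γ_K`-admissible subgroup `A ⊆ E(K̄)`
(the shape in which `hpointsRk_of_shimuraLabels_of_noTorsion_walk` delivers the labelled classes, `A m = E(emb m)(E(K[m]))`) — THIS FILE proves,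
from McCallum Cor. 4.5 both ways (p594723 `kolyvaginClass_eq_zero_iff_exists_mem_range`, here the hypothesis `h45` ∕ the range clause):
* `zsmul_kolyvaginClass_eq_kolyvaginClass_zsmul` — `j • c_n(P) = c_n(j • P)` (the tree's `cls_zsmul`, class form);
* `addOrderOf_kolyvaginClass_eq_of_not_exists_smul` — **exact order**: `Q ∈ A`, `Q ∉ p·A` ⟹ `addOrderOf c_{p^k}(Q) = p^k`;
* `exists_root_kolyvaginClass` — **the root class**: if `P ∈ p^μ A ∖ p^{μ+1} A` and `P`'s class mod `p^{k+μ} A` is `Γ_K`-invariant, then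
  `P = p^μ • Q` with `Q ∈ invPoints A (p^k)`, `Q ∉ p·A`, `addOrderOf c_{p^k}(Q) = p^k` and `c_{p^k}(P) = p^μ • c_{p^k}(Q)`;
* `kolyvaginClass_ne_zero_iff_not_exists_smul` — **hκ0 shape**: `c_{p^k}(P) ≠ 0 ↔ P ∉ p^k A`;
and the SHIMURA READINGS in the currency of the port targets (`ShimuraWalk.PDiv ∕ mdiv`, p592703), with the carrier's two bridge clauses as
hypotheses — clause (1) «`PDiv m μ → ∃ B ∈ A, p^μ·B = Pt`» (p594479) and its converse «`(∃ B ∈ A, p^μ·B = Pt) → μ ≤ D → PDiv m μ`» (the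
«one ⟹ all» transfer, `…ShimuraWalkPresentationTransfer` + the carrier re-issue to come): `exists_root_of_mdiv_eq` (hκt's `x` at
`m(s) = ShimuraWalk.mdiv = μ`) and `kolyvaginClass_ne_zero_iff_not_le_mdiv` (hκ0: `c_{p^k}(Pt) ≠ 0 ↔ ¬ k ≤ mdiv`).
HONEST FRAMING: theorems only (no definition, no named fact, no `sorry`); Kummer bookkeeping over the tree's cocycle API; nothing about any
curve's arithmetic; no stub closes; BSD is not proved by any of this; T7. References: [cite: McCallumLMS1991, §4 (6), Cor. 4.5, §5 p. 303–305]
[cite: GrossLMS1991, §4 (4.4), Prop. 4.7 (1)] [cite: Jetchev2008, §3.1 item 5, Lemma 5.2].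
presearch: «order of Kolyvagin class equals p^{M − ord_p P_n}» → [corpus: McCallumLMS1991 §5 p. 305 («the order of c_M(n) is p^{M−M₀}»);
Jetchev2008 Lemma 5.2] give the statement for X₀(N); tree twin for the X₀(N) datum: tam3's `…WalkTildeClass` ∕ corner-p1's `hordκ_of_admissibleData…`;
this generic carrier form: none (queries "order Kolyvagin class divisibility", "c_M(n) order"; corpus+galaxy).
-/

set_option autoImplicit false
set_option linter.dupNamespace false

noncomputable section

open scoped Classical

open WeierstrassCurve Field Literature.NumberTheory.EllipticCurves Literature.NumberTheory.EllipticCurves.KolyvaginCocycle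
  Literature.NumberTheory.GaloisRepresentations Literature.NumberTheory.EllipticCurves.RingClassField

namespace Summit.BirchSwinnertonDyer.BirchSwinnertonDyer.Theorems.ShimuraWalk

universe u

section Generic

variable {K : Type u} [Field K] {E : WeierstrassCurve K} {p k : ℕ}
  {hdiv : ∀ P : geomPoints E, ∃ Q : geomPoints E, ((p ^ k : ℕ) : ℤ) • Q = P}
  {A : AddSubgroup (geomPoints E)}

/-- `j • c_n(P) = c_n(j • P)` for a carrier-style class (the tree's `cls_zsmul` in class form, root `j • (P∕n)`).
[cite: GrossLMS1991, §4 (4.4)] [cite: McCallumLMS1991, §4 (6)] -/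
theorem zsmul_kolyvaginClass_eq_kolyvaginClass_zsmul (hA : IsAdmissible (absoluteGaloisGroup K) A ((p ^ k : ℕ) : ℤ))
    {P : geomPoints E} (hP : P ∈ invPoints (absoluteGaloisGroup K) A ((p ^ k : ℕ) : ℤ)) (j : ℤ)
    (hjP : j • P ∈ invPoints (absoluteGaloisGroup K) A ((p ^ k : ℕ) : ℤ)) :
    j • kolyvaginClass E ((p ^ k : ℕ) : ℤ) hdiv hA P hP = kolyvaginClass E ((p ^ k : ℕ) : ℤ) hdiv hA (j • P) hjP := by
  obtain ⟨Q₀, hQ₀⟩ := hdiv P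
  have hjQ : ((p ^ k : ℕ) : ℤ) • (j • Q₀) = j • P := by rw [smul_comm, hQ₀]
  rw [kolyvaginClass_eq_cls hA hP hQ₀, kolyvaginClass_eq_cls hA hjP hjQ,
    cls_zsmul hA (continuous_smul_geomPoints E) hP hQ₀ j hjP hjQ]

/-- No `p`-power torsion in an admissible `A`: `p^i • a = 0`, `a ∈ A`, `i ≤ k` ⟹ `a = 0`. [cite: McCallumLMS1991, §4 (5)] -/
theorem eq_zero_of_pow_smul_eq_zero (hA : IsAdmissible (absoluteGaloisGroup K) A ((p ^ k : ℕ) : ℤ))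
    {a : geomPoints E} (ha : a ∈ A) {i : ℕ} (hi : i ≤ k) (h0 : ((p ^ i : ℕ) : ℤ) • a = 0) : a = 0 := by
  refine hA.eq_zero_of_zsmul ha ?_
  rw [← Nat.sub_add_cancel hi, pow_add, Nat.cast_mul, mul_smul, h0, smul_zero]

/-- **Exact order of the class of a point outside `p·A`** (McCallum §5: «the order of `c_M(n)` is `p^{M − M₀}`» at `M₀ = 0`): for
`Q ∈ invPoints A (p^k)` with `Q ∉ p·A`, and Cor. 4.5 «only if» for the multiples of `Q` (hypothesis `h45`), `addOrderOf c_{p^k}(Q) = p^k`.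
[cite: McCallumLMS1991, Cor. 4.5, §5 p. 305] [cite: GrossLMS1991, Prop. 4.7 (1)] -/
theorem addOrderOf_kolyvaginClass_eq_of_not_exists_smul (hp : p.Prime)
    (hA : IsAdmissible (absoluteGaloisGroup K) A ((p ^ k : ℕ) : ℤ))
    {Q : geomPoints E} (hQ : Q ∈ invPoints (absoluteGaloisGroup K) A ((p ^ k : ℕ) : ℤ))
    (h45 : ∀ (j : ℤ) (hjQ : j • Q ∈ invPoints (absoluteGaloisGroup K) A ((p ^ k : ℕ) : ℤ)),
      kolyvaginClass E ((p ^ k : ℕ) : ℤ) hdiv hA (j • Q) hjQ = 0 → ∃ B ∈ A, ((p ^ k : ℕ) : ℤ) • B = j • Q)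
    (hnot : ¬ ∃ B ∈ A, (p : ℤ) • B = Q) :
    addOrderOf (kolyvaginClass E ((p ^ k : ℕ) : ℤ) hdiv hA Q hQ) = p ^ k := by
  set c := kolyvaginClass E ((p ^ k : ℕ) : ℤ) hdiv hA Q hQ with hc
  -- `p^k • c = 0`
  have hkQ : ((p ^ k : ℕ) : ℤ) • Q ∈ invPoints (absoluteGaloisGroup K) A ((p ^ k : ℕ) : ℤ) :=
    zsmul_mem_invPoints hA hQ.1
  have hk0 : ((p ^ k : ℕ) : ℤ) • c = 0 := by
    rw [hc, zsmul_kolyvaginClass_eq_kolyvaginClass_zsmul hA hQ _ hkQ]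
    obtain ⟨R, hR⟩ := hdiv (((p ^ k : ℕ) : ℤ) • Q)
    rw [kolyvaginClass_eq_cls hA hkQ hR]
    exact cls_eq_zero_of_mem hA _ hkQ hR ⟨Q, hQ.1, rfl⟩
  have hdvd : addOrderOf c ∣ p ^ k := by
    apply addOrderOf_dvd_of_nsmul_eq_zero
    rw [← natCast_zsmul]
    exact hk0
  obtain ⟨j, hjk, hj⟩ := (Nat.dvd_prime_pow hp).mp hdvd
  rw [hj]
  by_contra hne
  have hjlt : j < k := lt_of_le_of_ne hjk fun h ↦ hne (by rw [h])
  have hk1 : 1 ≤ k := by omega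
  -- then `p^(k-1) • c = 0`
  have hk1c : ((p ^ (k - 1) : ℕ) : ℤ) • c = 0 := by
    rw [natCast_zsmul, ← addOrderOf_dvd_iff_nsmul_eq_zero, hj]
    exact pow_dvd_pow p (by omega)
  have hk1Q : ((p ^ (k - 1) : ℕ) : ℤ) • Q ∈ invPoints (absoluteGaloisGroup K) A ((p ^ k : ℕ) : ℤ) :=
    AddSubgroup.zsmul_mem _ hQ _
  rw [hc, zsmul_kolyvaginClass_eq_kolyvaginClass_zsmul hA hQ _ hk1Q] at hk1c
  obtain ⟨B, hBA, hB⟩ := h45 _ hk1Q hk1c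
  -- `p^(k-1) • (p • B - Q) = 0` in the `p`-torsion-free `A`
  apply hnot
  refine ⟨B, hBA, ?_⟩
  have h0 : ((p ^ (k - 1) : ℕ) : ℤ) • ((p : ℤ) • B - Q) = 0 := by
    rw [smul_sub, smul_smul, sub_eq_zero, ← hB]
    congr 1
    rw [← Nat.cast_mul, ← pow_succ, Nat.sub_add_cancel hk1]
  exact sub_eq_zero.mp (eq_zero_of_pow_smul_eq_zero hA (A.sub_mem (A.zsmul_mem hBA _) hQ.1) (Nat.sub_le k 1) h0)

/-- **The root class** (Jetchev Lemma 5.2 ∕ McCallum §5 for carrier-style classes): if `P = p^μ·Q₀` with `Q₀ ∈ A`, `P ∉ p^{μ+1} A`, and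
`P`'s class is `Γ_K`-invariant modulo `p^{k+μ} A` (`P ∈ invPoints A (p^{k+μ})`; the carrier at Gross depth `≥ k + μ`), then for the root
`Q = Q₀`: `Q ∈ invPoints A (p^k)`, `Q ∉ p·A`, `addOrderOf c_{p^k}(Q) = p^k` (given Cor. 4.5 «only if» at level `p^k`, hypothesis `h45`) and
`c_{p^k}(P) = p^μ • c_{p^k}(Q)`. [cite: Jetchev2008, Lemma 5.2] [cite: McCallumLMS1991, §5 p. 305] [cite: GrossLMS1991, Prop. 4.7 (1)] -/
theorem exists_root_kolyvaginClass (hp : p.Prime)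
    (hA : IsAdmissible (absoluteGaloisGroup K) A ((p ^ k : ℕ) : ℤ)) {μ : ℕ}
    (hA' : IsAdmissible (absoluteGaloisGroup K) A ((p ^ (k + μ) : ℕ) : ℤ))
    {P : geomPoints E} (hP' : P ∈ invPoints (absoluteGaloisGroup K) A ((p ^ (k + μ) : ℕ) : ℤ))
    (hP : P ∈ invPoints (absoluteGaloisGroup K) A ((p ^ k : ℕ) : ℤ))
    (h45 : ∀ (R : geomPoints E) (hR : R ∈ invPoints (absoluteGaloisGroup K) A ((p ^ k : ℕ) : ℤ)),
      kolyvaginClass E ((p ^ k : ℕ) : ℤ) hdiv hA R hR = 0 → ∃ B ∈ A, ((p ^ k : ℕ) : ℤ) • B = R)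
    (hfwd : ∃ Q ∈ A, ((p ^ μ : ℕ) : ℤ) • Q = P) (hbwd : ¬ ∃ B ∈ A, ((p ^ (μ + 1) : ℕ) : ℤ) • B = P) :
    ∃ (Q : geomPoints E) (hQ : Q ∈ invPoints (absoluteGaloisGroup K) A ((p ^ k : ℕ) : ℤ)),
      ((p ^ μ : ℕ) : ℤ) • Q = P ∧ (¬ ∃ B ∈ A, (p : ℤ) • B = Q) ∧
      addOrderOf (kolyvaginClass E ((p ^ k : ℕ) : ℤ) hdiv hA Q hQ) = p ^ k ∧
      kolyvaginClass E ((p ^ k : ℕ) : ℤ) hdiv hA P hP = ((p ^ μ : ℕ) : ℤ) • kolyvaginClass E ((p ^ k : ℕ) : ℤ) hdiv hA Q hQ := by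
  obtain ⟨Q, hQA, hQP⟩ := hfwd
  -- `Q ∈ invPoints A (p^k)`: `p^μ • (γQ − Q) = γP − P ∈ p^{k+μ} A`
  have hQ : Q ∈ invPoints (absoluteGaloisGroup K) A ((p ^ k : ℕ) : ℤ) := by
    refine ⟨hQA, fun g ↦ ?_⟩
    obtain ⟨R, hRA, hR⟩ := hP'.2 g
    refine ⟨R, hRA, ?_⟩
    have h0 : ((p ^ μ : ℕ) : ℤ) • (((p ^ k : ℕ) : ℤ) • R - (g • Q - Q)) = 0 := by
      rw [smul_sub, smul_smul, ← Nat.cast_mul, ← pow_add, add_comm, hR, smul_sub, ← smul_zsmul_comm, hQP, sub_self]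
    exact sub_eq_zero.mp (eq_zero_of_pow_smul_eq_zero hA' (A.sub_mem (A.zsmul_mem hRA _)
      (A.sub_mem (hA.smul_mem g hQA) hQA)) (Nat.le_add_left μ k) h0)
  have hnot : ¬ ∃ B ∈ A, (p : ℤ) • B = Q := by
    rintro ⟨B, hBA, hB⟩
    exact hbwd ⟨B, hBA, by rw [pow_succ', Nat.cast_mul, mul_comm, mul_smul, hB, hQP]⟩
  refine ⟨Q, hQ, hQP, hnot, addOrderOf_kolyvaginClass_eq_of_not_exists_smul hp hA hQ (fun j hjQ h ↦ h45 _ hjQ h) hnot, ?_⟩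
  have hμQ : ((p ^ μ : ℕ) : ℤ) • Q ∈ invPoints (absoluteGaloisGroup K) A ((p ^ k : ℕ) : ℤ) := by rw [hQP]; exact hP
  rw [zsmul_kolyvaginClass_eq_kolyvaginClass_zsmul hA hQ _ hμQ]
  -- the two classes of the same point `p^μ • Q = P` agree
  obtain ⟨R, hR⟩ := hdiv P
  have hR' : ((p ^ k : ℕ) : ℤ) • R = ((p ^ μ : ℕ) : ℤ) • Q := by rw [hR, hQP]
  rw [kolyvaginClass_eq_cls hA hP hR, kolyvaginClass_eq_cls hA hμQ hR']
  exact cls_congr hA _ hQP.symm rfl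

/-- **hκ0 shape** (McCallum Cor. 4.5 read as non-vanishing): `c_{p^k}(P) ≠ 0 ↔ P ∉ p^k A`, given Cor. 4.5 both ways for `P`.
[cite: McCallumLMS1991, Cor. 4.5] -/
theorem kolyvaginClass_ne_zero_iff_not_exists_smul (hA : IsAdmissible (absoluteGaloisGroup K) A ((p ^ k : ℕ) : ℤ))
    {P : geomPoints E} (hP : P ∈ invPoints (absoluteGaloisGroup K) A ((p ^ k : ℕ) : ℤ))
    (h45 : kolyvaginClass E ((p ^ k : ℕ) : ℤ) hdiv hA P hP = 0 ↔ ∃ B ∈ A, ((p ^ k : ℕ) : ℤ) • B = P) :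
    kolyvaginClass E ((p ^ k : ℕ) : ℤ) hdiv hA P hP ≠ 0 ↔ ¬ ∃ B ∈ A, ((p ^ k : ℕ) : ℤ) • B = P :=
  not_congr h45

end Generic

section Shimura

variable {K : Type} [Field K] [NumberField K] {ι : K →+* ℂ}

/-- **hκt's root class for the labelled Shimura classes, in the currency of the port targets**: for a carrier package at an admissible
level `m` — `A = E(e)(E(K[m]))` (clause (2) of `hpointsRk_of_shimuraLabels_of_noTorsion_walk`), admissible for `p^k` and `p^{k+μ}`, the
point `Pt ∈ invPoints A (p^{k+μ})`, clause (1) «`PDiv … m ν → ∃ B ∈ A, p^ν·B = Pt`» and its converse up to depth `D ≥ μ + 1` — if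
`ShimuraWalk.mdiv hK ι W y p m = μ` then `Pt = p^μ • Q` with `addOrderOf c_{p^k}(Q) = p^k` and `c_{p^k}(Pt) = p^μ • c_{p^k}(Q)`.
CONDITIONAL on the displayed package; nothing booked. [cite: Jetchev2008, §3.1 item 5, Lemma 5.2] [cite: McCallumLMS1991, §5 p. 305] -/
theorem exists_root_of_mdiv_eq (hK : IsImaginaryQuadratic K) (W : WeierstrassCurve ℚ) {m : ℕ}
    (e : ringClassField K ι m →ₐ[K] AlgebraicClosure K)
    (y : (n : ℕ) → (W.baseChange (ringClassField K ι n)).toAffine.Point) {p k μ D : ℕ} (hp : p.Prime)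
    {hdiv : ∀ P : geomPoints (W.baseChange K), ∃ Q : geomPoints (W.baseChange K), ((p ^ k : ℕ) : ℤ) • Q = P}
    {A : AddSubgroup (geomPoints (W.baseChange K))}
    (hAe : A = (Affine.Point.map (W' := W) e.toRingHom.toRatAlgHom :
      (W.baseChange (ringClassField K ι m)).toAffine.Point →+ geomPoints (W.baseChange K)).range)
    (hA : IsAdmissible (absoluteGaloisGroup K) A ((p ^ k : ℕ) : ℤ))
    (hA' : IsAdmissible (absoluteGaloisGroup K) A ((p ^ (k + μ) : ℕ) : ℤ))
    {Pt : geomPoints (W.baseChange K)} (hPt' : Pt ∈ invPoints (absoluteGaloisGroup K) A ((p ^ (k + μ) : ℕ) : ℤ))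
    (hPt : Pt ∈ invPoints (absoluteGaloisGroup K) A ((p ^ k : ℕ) : ℤ))
    (hbridge : ∀ ν : ℕ, PDiv hK ι W y p m ν → ∃ B ∈ A, ((p ^ ν : ℕ) : ℤ) • B = Pt)
    (hbridge' : ∀ ν : ℕ, ν ≤ D → (∃ B ∈ A, ((p ^ ν : ℕ) : ℤ) • B = Pt) → PDiv hK ι W y p m ν)
    (hμD : μ + 1 ≤ D) (hmdiv : mdiv hK ι W y p m = (μ : ℕ∞)) :
    ∃ (Q : geomPoints (W.baseChange K)) (hQ : Q ∈ invPoints (absoluteGaloisGroup K) A ((p ^ k : ℕ) : ℤ)),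
      ((p ^ μ : ℕ) : ℤ) • Q = Pt ∧ (¬ ∃ B ∈ A, (p : ℤ) • B = Q) ∧
      addOrderOf (kolyvaginClass (W.baseChange K) ((p ^ k : ℕ) : ℤ) hdiv hA Q hQ) = p ^ k ∧
      kolyvaginClass (W.baseChange K) ((p ^ k : ℕ) : ℤ) hdiv hA Pt hPt =
        ((p ^ μ : ℕ) : ℤ) • kolyvaginClass (W.baseChange K) ((p ^ k : ℕ) : ℤ) hdiv hA Q hQ := by
  refine exists_root_kolyvaginClass hp hA hA' hPt' hPt
    (fun R hR h ↦ (kolyvaginClass_eq_zero_iff_exists_mem_range e hAe hA hR).mp h) ?_ ?_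
  · exact hbridge μ ((natCast_le_mdiv_iff hK ι W y p m μ).mp (by rw [hmdiv]))
  · intro h
    have hle : ((μ + 1 : ℕ) : ℕ∞) ≤ mdiv hK ι W y p m :=
      (natCast_le_mdiv_iff hK ι W y p m (μ + 1)).mpr (hbridge' (μ + 1) hμD h)
    rw [hmdiv] at hle
    have : μ + 1 ≤ μ := by exact_mod_cast hle
    omega

/-- **hκ0 for the labelled Shimura classes**: with the package of `exists_root_of_mdiv_eq` (Cor. 4.5 both ways from `A = E(e)(E(K[m]))`, the two
bridge clauses up to depth `D ≥ k`), `c_{p^k}(Pt) ≠ 0 ↔ ¬ (k : ℕ∞) ≤ ShimuraWalk.mdiv hK ι W y p m` — the `hκ0` binder of the swap engine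
`Koly.exists_deep_of_swapFamilies_of_classes` (p593233) at `ND s := ¬ k ≤ mdiv`. CONDITIONAL; nothing booked. [cite: McCallumLMS1991, Cor. 4.5, Prop. 5.2] -/
theorem kolyvaginClass_ne_zero_iff_not_le_mdiv (hK : IsImaginaryQuadratic K) (W : WeierstrassCurve ℚ) {m : ℕ}
    (e : ringClassField K ι m →ₐ[K] AlgebraicClosure K)
    (y : (n : ℕ) → (W.baseChange (ringClassField K ι n)).toAffine.Point) {p k D : ℕ}
    {hdiv : ∀ P : geomPoints (W.baseChange K), ∃ Q : geomPoints (W.baseChange K), ((p ^ k : ℕ) : ℤ) • Q = P}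
    {A : AddSubgroup (geomPoints (W.baseChange K))}
    (hAe : A = (Affine.Point.map (W' := W) e.toRingHom.toRatAlgHom :
      (W.baseChange (ringClassField K ι m)).toAffine.Point →+ geomPoints (W.baseChange K)).range)
    (hA : IsAdmissible (absoluteGaloisGroup K) A ((p ^ k : ℕ) : ℤ))
    {Pt : geomPoints (W.baseChange K)} (hPt : Pt ∈ invPoints (absoluteGaloisGroup K) A ((p ^ k : ℕ) : ℤ))
    (hbridge : ∀ ν : ℕ, PDiv hK ι W y p m ν → ∃ B ∈ A, ((p ^ ν : ℕ) : ℤ) • B = Pt)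
    (hbridge' : ∀ ν : ℕ, ν ≤ D → (∃ B ∈ A, ((p ^ ν : ℕ) : ℤ) • B = Pt) → PDiv hK ι W y p m ν) (hkD : k ≤ D) :
    kolyvaginClass (W.baseChange K) ((p ^ k : ℕ) : ℤ) hdiv hA Pt hPt ≠ 0 ↔ ¬ (k : ℕ∞) ≤ mdiv hK ι W y p m := by
  rw [kolyvaginClass_ne_zero_iff_not_exists_smul hA hPt (kolyvaginClass_eq_zero_iff_exists_mem_range e hAe hA hPt),
    natCast_le_mdiv_iff]
  exact not_congr ⟨fun h ↦ hbridge' k hkD h, fun h ↦ hbridge k h⟩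

end Shimura

end Summit.BirchSwinnertonDyer.BirchSwinnertonDyer.Theorems.ShimuraWalk

end
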